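import Mathlib.NumberTheory.Padics.PadicNumbers
import Mathlib.Analysis.Normed.Field.Basic
import HarnessLib

/-!
# The unit step of hLog₀'s clause (e): the simultaneous Néron rescaling is a `p`-adic unit, and the
# integrality transfer (cell `bsd-addord`, seat w2-acc4 gen 5 = owner of `hLog₀` of crux 19560; helper)

HONEST FRAMING.  Crux 19560 `KatoKuriharaPortThreeShared`, part hLog₀ (kim3 p508902) ⟸
`KimAtThreeFineKatoHLog.perFactorLog_of_dualInt` (w2-acc4 p511995) ⟸ the displayed duality hypotheses
hDualTame / hDualWild (DUALINT).  DUALINT follows from the print fact (S5b-tower) (w2-c3,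
`Literature.NumberTheory.PAdicHodge.exists_smul_range_expStarCoord_tower_iff_trace_log`: ONE rescaling
`e ∈ ℚ_vˣ` normalises `exp*` at `ℚ_v` AND at `L_w`) by two ELEMENTARY steps, isolated here free of any
Galois-cohomology currency so that the final assembly is bookkeeping:

* `norm_eq_one_of_forall_iff_norm_le_one` — if two maps `f, g : H → ℚ_p` with `g = c⁻¹ · f` BOTH have range
  the unit ball `{‖a‖ ≤ 1}` (for `f = exp*_d` this is `hdual` on the Kato stratum, kim3's
  `forall_norm_mul_padicLog_le_one_iff_three`; for `g = exp*_{e•d}` it is the first conjunct of (S5b-tower)),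
  then **`‖c‖ = 1`** (`1 ∈ range g ⇒ c ∈ range f`, `1 ∈ range f ⇒ c⁻¹ ∈ range g`);
* `forall_norm_apply_mul_le_one_of_range` — if `g = c'⁻¹ · f : H → K` has range the `T`-dual of a set `S`
  (`a ∈ range g ↔ ∀ ℓ ∈ S, ‖T (a·ℓ)‖ ≤ 1`, the second conjunct of (S5b-tower) at `K = L_w` with
  `T = e₃⁻¹ ∘ Tr_{L_w/ℚ_v}`) and `T (c'·x) = c · T x` with `‖c‖ ≤ 1`, then **`‖T (f y · ℓ)‖ ≤ 1`** for all
  `y` and `ℓ ∈ S` — clause (e) of hLog₀ for `Λ₀ ⊆ S`.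

TOOL theorems only (no definition, no named fact, no `sorry`); closes nothing; nothing booked; BSD / 19560 not
proved by any of this.  References: S. Bloch, K. Kato (1990) §3 Prop. 3.8 [BlochKato1990]; K. Kato, LNM 1553
(1993) II Thm. 1.4.1 [Kato1993LNM1553]; w2-acc4 FINDING-E / kim3 LEAD decision (bsd-addord STATUS 2026-08-27).
-/

-- the cell's Theorems namespace `Summit.BirchSwinnertonDyer.BirchSwinnertonDyer.…` repeats the summit name by design (D-0017)
set_option linter.dupNamespace false

namespace Summit.BirchSwinnertonDyer.BirchSwinnertonDyer.Theorems.KimAtThreeFineKatoHLog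

variable {p : ℕ} [Fact p.Prime]

/-- **The simultaneous rescaling is a unit.**  If `f, g : H → ℚ_p` satisfy `g y = c⁻¹ · f y` and BOTH have
range exactly the unit ball, then `‖c‖ = 1`. -/
theorem norm_eq_one_of_forall_iff_norm_le_one {H : Type*} (f g : H → ℚ_[p]) (c : ℚ_[p])
    (hf : ∀ a : ℚ_[p], (∃ y, f y = a) ↔ ‖a‖ ≤ 1) (hg : ∀ a : ℚ_[p], (∃ y, g y = a) ↔ ‖a‖ ≤ 1)
    (hrel : ∀ y, g y = c⁻¹ * f y) : ‖c‖ = 1 := by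
  obtain ⟨y₁, hy₁⟩ := (hg 1).mpr (by rw [norm_one])
  have hc0 : c ≠ 0 := by
    rintro rfl
    rw [hrel, inv_zero, zero_mul] at hy₁
    exact zero_ne_one hy₁
  -- `‖c‖ ≤ 1`: `c = f y₁ ∈ range f`
  have hle : ‖c‖ ≤ 1 := by
    refine (hf c).mp ⟨y₁, ?_⟩
    rw [hrel] at hy₁
    have := congrArg (c * ·) hy₁
    simpa [← mul_assoc, mul_inv_cancel₀ hc0] using this
  -- `‖c⁻¹‖ ≤ 1`: `c⁻¹ = g y₂ ∈ range g` for `f y₂ = 1`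
  obtain ⟨y₂, hy₂⟩ := (hf 1).mpr (by rw [norm_one])
  have hle' : ‖c⁻¹‖ ≤ 1 := (hg c⁻¹).mp ⟨y₂, by rw [hrel, hy₂, mul_one]⟩
  rw [norm_inv] at hle'
  have hpos : 0 < ‖c‖ := norm_pos_iff.mpr hc0
  have h1 : 1 ≤ ‖c‖ := by
    have := inv_le_one_iff₀.mp hle'
    rcases this with h | h
    · exact absurd h (not_le.mpr hpos)
    · exact h
  exact le_antisymm hle h1

/-- **Integrality transfer.**  If `g y = c'⁻¹ · f y` (`f, g : H → K`) where the range of `g` is the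
`T`-dual of a set `S ⊆ K` and `T (c'·x) = c · T x` with `‖c‖ ≤ 1` (`T : K → ℚ_p`, e.g. `e₃⁻¹ ∘ Tr_{K/ℚ_v}`,
`c' = e` read in `K`), then `‖T (f y · ℓ)‖ ≤ 1` for every `y` and `ℓ ∈ S`. -/
theorem forall_norm_apply_mul_le_one_of_range {H K : Type*} [Field K] (f g : H → K) (T : K → ℚ_[p])
    (S : Set K) (c' : K) (c : ℚ_[p]) (hc' : c' ≠ 0) (hc : ‖c‖ ≤ 1)
    (hT : ∀ x : K, T (c' * x) = c * T x)
    (hg : ∀ a : K, (∃ y, g y = a) ↔ ∀ ℓ ∈ S, ‖T (a * ℓ)‖ ≤ 1)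
    (hrel : ∀ y, g y = c'⁻¹ * f y) (y : H) {ℓ : K} (hℓ : ℓ ∈ S) :
    ‖T (f y * ℓ)‖ ≤ 1 := by
  have hgy : ∀ ℓ ∈ S, ‖T (g y * ℓ)‖ ≤ 1 := (hg (g y)).mp ⟨y, rfl⟩
  have hf : f y = c' * g y := by
    rw [hrel, ← mul_assoc, mul_inv_cancel₀ hc', one_mul]
  rw [hf, mul_assoc, hT, norm_mul]
  calc ‖c‖ * ‖T (g y * ℓ)‖ ≤ 1 * 1 := mul_le_mul hc (hgy ℓ hℓ) (norm_nonneg _) zero_le_one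
    _ = 1 := one_mul 1

end Summit.BirchSwinnertonDyer.BirchSwinnertonDyer.Theorems.KimAtThreeFineKatoHLog
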